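import Literature.AnabelianGeometry.SemiGraphs.TreeSystemFixedPointTopological

/-!
# Compatible fixed vertices in the finite Galois quotients ([SemiAnbd] Thm. 3.7 (iii), p. 41)

Mochizuki, *Semi-graphs of Anabelioids*, Publ. RIMS **42** (2006) 221–322, proof of Theorem 3.7
(iii), first part (p. 41) [cite: MochizukiSemiAnbd2006, Thm. 3.7(iii) p.41]: "Since the `𝒢_i` are
FINITE semi-graphs, it thus follows that by replacing our cofinal system `{𝒢_i → 𝒢}` with some
cofinal subsystem … we obtain a compatible system of vertices `ṽ = {v_i}` of the `𝒢_i` fixed by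
`H`; in particular, it follows that `H ⊆ π₁^temp(𝒢)_ṽ`."

The fixed point is PRODUCED on the tree `𝒢_{∞,i}` (Lemma 1.8 (ii)(a), no branch switching over
`𝒢`: `TreeSystemFixedPointTopological.lean`) and PUSHED DOWN to the finite semi-graph `𝒢_i`, whose
set of `H`-fixed vertices is therefore finite and nonempty; a compatible system then exists by the
finiteness of the levels (`TreeSystemFixedPoint.exists_compatible_of_finite`).  This is the form
of the argument in which no finiteness of fixed-vertex sets in the (infinite) trees is needed
(reading of abc-iut-L3-t11, order of record of abc-iut-L3-lead 21:22Z).  Proof-only; the acting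
group is a topological group `P ⊇ C` compact, acting on the trees through homomorphisms with open
kernels and on the finite vertex sets `V_j` of the quotients compatibly with the projections
`q_j : Vert(T_j) → V_j` and with the transition maps `π : V_j → V_i`.

* `exists_compatible_fixed_points_of_quotients` — the compatible system of `C`-fixed points of the
  finite levels.
-/

namespace Literature.AnabelianGeometry.SemiGraphs

namespace SemiGraph

open CategoryTheory Topology

universe u v w w'

/-- **Compatible system of fixed vertices of the finite levels** (proof of Thm. 3.7 (iii), p. 41):
`C ≤ P` compact; for each level `j` a tree `T_j` over `𝔾` with a vertex, acted on by `P` over `𝔾`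
through a homomorphism with open kernel, a finite set `V_j` (the vertices of the finite quotient
`𝒢_j`) with a `P`-action and a `P`-equivariant map `q_j : Vert(T_j) → V_j`; the `V_j` form an
inverse system with `P`-equivariant transition maps.  Then there is a compatible system
`(x_j)_j`, `x_j ∈ V_j` fixed by `C`. [cite: MochizukiSemiAnbd2006, Thm. 3.7(iii) p.41] -/
theorem exists_compatible_fixed_points_of_quotients {P : Type w} [Group P] [TopologicalSpace P]
    [IsTopologicalGroup P] (C : Subgroup P) (hC : IsCompact (C : Set P))
    {J : Type v} [Preorder J] [IsDirectedOrder J] (𝔾 : SemiGraph.{u}) (T : J → SemiGraph.{u})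
    (hT : ∀ j, (T j).IsTree) (v₀ : ∀ j, (T j).Vertex) (p : ∀ j, T j ⟶ 𝔾)
    (ρ : ∀ j, P →* Aut (T j)) (hker : ∀ j, IsOpen ((ρ j).ker : Set P))
    (hover : ∀ (j : J) (g : P), (ρ j g).hom ≫ p j = p j)
    (V : J → Type w') [∀ j, Finite (V j)] (σ : ∀ j, P → V j → V j)
    (q : ∀ j, (T j).Vertex → V j)
    (hq : ∀ (j : J) (g : P) (x : (T j).Vertex), q j ((ρ j g).hom.vertexMap x) = σ j g (q j x))
    (π : ∀ ⦃i j : J⦄, i ≤ j → V j → V i)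
    (π_id : ∀ (j : J) (x : V j), π le_rfl x = x)
    (π_comp : ∀ ⦃i j k : J⦄ (hij : i ≤ j) (hjk : j ≤ k) (x : V k),
      π hij (π hjk x) = π (hij.trans hjk) x)
    (hequiv : ∀ ⦃i j : J⦄ (h : i ≤ j) (g : P) (x : V j), π h (σ j g x) = σ i g (π h x)) :
    ∃ x : ∀ j, V j, (∀ (j : J) (c : C), σ j c (x j) = x j) ∧
      ∀ ⦃i j : J⦄ (h : i ≤ j), π h (x j) = x i := by
  -- the `C`-fixed points of the finite levels: finite, nonempty (pushed down from the tree), and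
  -- stable under the transition maps
  obtain ⟨x, hx, hcompat⟩ := exists_compatible_of_finite π π_id π_comp
    (fun j => {y : V j | ∀ c : C, σ j c y = y}) (fun j => Set.toFinite _)
    (fun j => by
      obtain ⟨v, hv⟩ := exists_fixed_vertex_of_isCompact_over C hC (hT j) (v₀ j) (p j) (ρ j)
        (hker j) (hover j)
      refine ⟨q j v, fun c => ?_⟩
      have h := hq j c v
      rw [hv c] at h
      exact h.symm)
    (fun i j h y hy c => by
      have e := hequiv h c y
      rw [hy c] at e
      exact e.symm)
  exact ⟨x, fun j c => hx j c, hcompat⟩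

end SemiGraph

end Literature.AnabelianGeometry.SemiGraphs
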